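import Literature.AnabelianGeometry.SemiGraphs.CoveringGraphIsoOver
import Literature.AnabelianGeometry.SemiGraphs.TemperedFunctorialityWith
import Literature.AnabelianGeometry.SemiGraphs.ProfiniteSemiGraphHomComp
import Literature.AnabelianGeometry.SemiGraphs.CoveringHomLocallyOpen
import HarnessLib

/-!
# [SemiAnbd] §2 p.23 / Prop 4.4 (i) / Prop 4.6: the FIBRE SQUARE of a covering along a morphism — the
# second projection `𝒢'_{ψ^*S} → 𝒢_S` of the pull-back of `S ∈ B^cov(G)` along `ψ : G' → G` (profinite presentation)

Mochizuki, *Semi-graphs of anabelioids*, Publ. RIMS **42** (2006), §2 p. 23 («the pull-backs `B′ ×_B 𝒢_v`» of a finite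
étale covering along a morphism), Def. 3.5 (i) p. 37 (the covering `𝒢_S → 𝒢` of `S ∈ B^cov(G)`), Prop. 3.6 (iv) p. 39 («by
pulling back … coverings of `𝒢` to … coverings of `𝒢′`»), and the two places of §4 where it is USED: Prop. 4.4 (i) p. 54 («any
connected component `H′` of the pull-back of this finite étale covering to `H`») and the proof of Prop. 4.6 p. 56 («By pulling
back the finite étale morphism `H → K` to `H₁` …»), p. 57 («By base-changing `H → K` by some finite étale morphism as in
Proposition 4.4, (i) …») (kurims `paper:url-f33ace170ff4`). [cite: MochizukiSemiAnbd2006, Prop 3.6(iv) p.39]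

abc-iut cell, layer L3, seat abc-iut-f-161 gen 8 (covering-realisation lineage t3/f-161/d6), L3-lead row
«PROP46⟸PULLBACK+P44i» stage 1a (SHAPES HOME/staging/f/f-161/g8/SHAPES-PROP46-PULLBACK.md).  DEFINITIONS + kernel-checked
bookkeeping at abc-iut-L3-t2's profinite presentation (`ProfiniteSemiGraph`, `CovObj`, `CovObj.coveringGraph` /
`coveringHom`), over abc-iut-L3-d4's pull-back functor `Hom.covPullbackWith θ` and abc-iut-L3-t3's point-lift machinery
(`CovObj.pointLift`, `GlueCondition`, `gV`/`gE`, `conjInto`; `CoveringGraphPointLift` / `CoveringGraphIsoOver`):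

* §1 `CovObj.StabLE` / `pointHVLE` / `pointHELE` / `pointHomLE` — abc-iut-L3-t3's morphism `X → 𝒢_S` over the point lift,
  with the stabiliser dictionary (PS2) `range(p_w) = Stab(y_w)` WEAKENED to `p_w(Π_{X,w}) ⊆ Stab(y_w)` (which is all that
  `conjInto` consumes); `StabCondition.stabLE` recovers t3's case.  The branch squares commute up to STABILISER elements
  (`pointHomLE_comm`, the computation of `CovObj.pointHom_comm` verbatim).  (Code adapted from `CoveringGraphIsoOver.lean`,
  same cell.)
* §2 for `ψ : Hom G' G`, a family of conjugating elements `θ` and `S ∈ B^cov(G)`, with `S′ := (ψ.covPullbackWith θ).obj S`: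
  the TAUTOLOGICAL point system of the composite `𝒢'_{S′} → G′ → G` (`y_{(w,o)} := pt o`, a point of `S′_w = ψ_w^* S_{ψ w}`
  IS a point of `S_{ψ w}`) satisfies the gluing condition, the weak stabiliser condition and (PS3) point alignment
  (aligned conjugator `ψ_w(c′)·θ_{b′}`, `c′` the incidence conjugator of `𝒢'_{S′}`) — `covPullback_glueCondition`,
  `covPullback_stabLE`, `covPullback_pointAligned`;
* **`Hom.covPullbackSnd ψ θ S : Hom (S′.coveringGraph) (S.coveringGraph)`** — the second projection of the fibre square,
  with `covPullbackSnd_base_comp` (THE SQUARE on underlying semi-graphs: `snd ≫ (𝒢_S → G) = (𝒢'_{S′} → G′) ≫ ψ`),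
  `covPullbackSnd_base_vertexMap/edgeMap` (a vertex `(w, o)` goes to `(ψ w, Π_{ψ w}·pt o)`), `covPullbackSnd_hV` / `_hE`
  and `covPullbackSnd_hV_coe` / `_hE_coe` (constituents = `ψ_w` on the stabiliser followed by an inner automorphism of
  `Π_{G,ψ w}`: the constituent squares commute up to conjugation, the shape of `ProfiniteSemiGraph.Hom.comm`),
  `covPullbackSnd_hV_injective` / `_hE_injective` (injective where `ψ` is).
Deliberately NOT here (stage 1b/2 of the row): the `Loc(𝔾, Γ)`-object structure on the components of `𝒢'_{S′}` and the
cartesian property in cone form.  Nothing printed is asserted; no side taken on [IUTchIII] Cor. 3.12.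
-/

noncomputable section

namespace Literature.AnabelianGeometry.SemiGraphs

open CategoryTheory
open Literature.AlgebraicGeometry.Frobenioids.QuasiTemperoid.BTempConnected (hom_ρ ρ_one_apply
  ρ_mul_apply ρ_inv_apply)

universe u

namespace ProfiniteSemiGraph

/-! ## §1. The point-lift morphism under the WEAK stabiliser condition -/

namespace CovObj

variable {X P : ProfiniteSemiGraph.{u}} (p : Hom X P) (S : CovObj P)
  (y : ∀ w : X.graph.Vertex, (S.SV (p.base.vertexMap w)).obj.V)
  (z : ∀ e' : X.graph.Edge, (S.SE (p.base.edgeMap e')).obj.V)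

/-- The WEAK stabiliser condition on a point system: `p_w(Π_{X,w}) ⊆ Stab(y_w)` and `p_{e'}(Π_{X,e'}) ⊆ Stab(z_{e'})`
(no injectivity, no equality — the shape satisfied by a composite `𝒢'_{ψ^*S} → G′ → G`).
[cite: MochizukiSemiAnbd2006, Rem. 2.2.1 p.24] -/
@[mk_iff] structure StabLE : Prop where
  /-- `p_w` lands in `Stab(y_w)` -/
  mem_hV : ∀ (w : X.graph.Vertex) (x : X.Gv w), p.hV w x ∈ BTemp.stab (S.SV (p.base.vertexMap w)) (y w)
  /-- `p_{e'}` lands in `Stab(z_{e'})` -/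
  mem_hE : ∀ (e' : X.graph.Edge) (x : X.Ge e'), p.hE e' x ∈ BTemp.stab (S.SE (p.base.edgeMap e')) (z e')

variable {p S y z}

/-- abc-iut-L3-t3's stabiliser DICTIONARY (PS2) implies the weak condition. [cite: MochizukiSemiAnbd2006, Rem. 2.2.1 p.24] -/
theorem StabCondition.stabLE (hS : StabCondition p S y z) : StabLE p S y z :=
  ⟨fun w x => by rw [← hS.range_hV w]; exact ⟨x, rfl⟩, fun e' x => by rw [← hS.range_hE e']; exact ⟨x, rfl⟩⟩

variable (p S y z)
variable (hglue : S.GlueCondition p.base y z) (hS : StabLE p S y z)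

/-- The vertex homomorphism `Π_{X,w} → Stab(x_{[y_w]}) = Π_{𝒢_S, (p w, [y_w])}` under the weak condition: `p_w` followed by
conjugation by abc-iut-L3-t3's chosen `g_w` (`g_w · y_w = x_{[y_w]}`). [cite: MochizukiSemiAnbd2006, Def 3.5(i) p.37] -/
def pointHVLE (w : X.graph.Vertex) :
    X.Gv w →ₜ* BTemp.stab (S.SV (p.base.vertexMap w)) (Quot.out (BTemp.cl (S.SV _) (y w))) :=
  conjInto (p.hV w) (gV p S y w) _ fun x => conj_mem_stab _ _ _ (gV_spec p S y w) (hS.mem_hV w x)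

/-- Value of the vertex homomorphism. [cite: MochizukiSemiAnbd2006, Def 3.5(i) p.37] -/
@[simp] theorem pointHVLE_apply_coe (w : X.graph.Vertex) (x : X.Gv w) :
    (pointHVLE p S y z hS w x : P.Gv (p.base.vertexMap w)) = gV p S y w * p.hV w x * (gV p S y w)⁻¹ := rfl

/-- The edge homomorphism `Π_{X,e'} → Stab(x_{[z_{e'}]})` under the weak condition. [cite: MochizukiSemiAnbd2006, Def 3.5(i) p.37] -/
def pointHELE (e' : X.graph.Edge) :
    X.Ge e' →ₜ* BTemp.stab (S.SE (p.base.edgeMap e')) (Quot.out (BTemp.cl (S.SE _) (z e'))) :=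
  conjInto (p.hE e') (gE p S z e') _ fun x => conj_mem_stab _ _ _ (gE_spec p S z e') (hS.mem_hE e' x)

/-- Value of the edge homomorphism. [cite: MochizukiSemiAnbd2006, Def 3.5(i) p.37] -/
@[simp] theorem pointHELE_apply_coe (e' : X.graph.Edge) (x : X.Ge e') :
    (pointHELE p S y z hS e' x : P.Ge (p.base.edgeMap e')) = gE p S z e' * p.hE e' x * (gE p S z e')⁻¹ := rfl

/-- The vertex homomorphism is injective when `p_w` is. [cite: MochizukiSemiAnbd2006, Rem. 2.2.1 p.24] -/
theorem pointHVLE_injective (w : X.graph.Vertex) (hw : Function.Injective (p.hV w)) :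
    Function.Injective (pointHVLE p S y z hS w) :=
  conjInto_injective _ _ _ _ hw

/-- The edge homomorphism is injective when `p_{e'}` is. [cite: MochizukiSemiAnbd2006, Rem. 2.2.1 p.24] -/
theorem pointHELE_injective (e' : X.graph.Edge) (he : Function.Injective (p.hE e')) :
    Function.Injective (pointHELE p S y z hS e') :=
  conjInto_injective _ _ _ _ he

/-- **The branch squares commute up to STABILISER elements** (abc-iut-L3-t3's `pointHom_comm`, weak condition): with `k`
the aligned conjugator of (PS3), `c` the incidence conjugator of `𝒢_S` and `g_w`, `g_{e'}` the chosen translations, the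
element `γ := g_w k (c · b_*(g_{e'}))⁻¹` fixes `x_{[y_w]}` and conjugates the one composite into the other.
[cite: MochizukiSemiAnbd2006, Def 3.5(i) p.37] -/
theorem pointHomLE_comm (hPA : PointAligned p S y z) (b' : X.graph.Branch) (w : X.graph.Vertex)
    (h' : X.graph.abuts b' = some w) :
    ∃ γ : S.coveringGraph.Gv ((S.pointLift p.base y z hglue).vertexMap w),
      ∀ x : X.Ge (X.graph.edgeOf b'),
        pointHVLE p S y z hS w (X.brHom b' w h' x) =
          γ * S.coveringGraph.brHom ((S.pointLift p.base y z hglue).branchMap b')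
              ((S.pointLift p.base y z hglue).vertexMap w)
              ((S.pointLift p.base y z hglue).abuts_branchMap b' w h')
              ((S.pointLift p.base y z hglue).edgeOf_branchMap b' ▸ pointHELE p S y z hS (X.graph.edgeOf b') x) *
            γ⁻¹ := by
  -- adapted from `CovObj.pointHom_comm` (`CoveringGraphIsoOver.lean`, same cell): `hS` enters only through `conjInto`
  obtain ⟨k, hk, hky⟩ := hPA.exists_conj b' w h'
  have hab : S.coveringSemiGraph.abuts ((S.pointLift p.base y z hglue).branchMap b') =
      some ((S.pointLift p.base y z hglue).vertexMap w) :=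
    (S.pointLift p.base y z hglue).abuts_branchMap b' w h'
  have hcspec := S.conjugator_spec hab
  have hεz : (S.SV (p.base.vertexMap w)).obj.ρ
      (S.conjugator hab * P.brHom (p.base.branchMap b') (p.base.vertexMap w)
        (p.base.abuts_branchMap b' w h')
        (P.castGe (p.base.edgeOf_branchMap b').symm (gE p S z (X.graph.edgeOf b'))))
      ((S.glue (p.base.branchMap b') (p.base.vertexMap w) (p.base.abuts_branchMap b' w h')).hom.hom.hom
        (S.castPtE (p.base.edgeOf_branchMap b').symm (z (X.graph.edgeOf b')))) =
      Quot.out (BTemp.cl (S.SV (p.base.vertexMap w)) (y w)) := by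
    rw [ρ_mul_apply, ← glue_ρ, ← castPtE_ρ, gE_spec, ← out_cl_castPtE]
    exact hcspec
  have hγ : gV p S y w * k *
      (S.conjugator hab * P.brHom (p.base.branchMap b') (p.base.vertexMap w)
        (p.base.abuts_branchMap b' w h')
        (P.castGe (p.base.edgeOf_branchMap b').symm (gE p S z (X.graph.edgeOf b'))))⁻¹ ∈
      BTemp.stab (S.SV (p.base.vertexMap w)) (Quot.out (BTemp.cl (S.SV (p.base.vertexMap w)) (y w))) := by
    change (S.SV (p.base.vertexMap w)).obj.ρ _ _ = _
    rw [ρ_mul_apply, ρ_mul_apply]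
    nth_rewrite 1 [← hεz]
    rw [ρ_inv_apply, hky, gV_spec]
  refine ⟨⟨_, hγ⟩, fun x => Subtype.ext ?_⟩
  rw [pointHVLE_apply_coe, hk x, Subgroup.coe_mul, Subgroup.coe_mul, Subgroup.coe_inv,
    coe_coveringGraph_brHom, S.coe_cast_coveringGraph_Ge ((S.pointLift p.base y z hglue).edgeOf_branchMap b'),
    pointHELE_apply_coe]
  change gV p S y w * (k * P.brHom (p.base.branchMap b') (p.base.vertexMap w)
      (p.base.abuts_branchMap b' w h')
      (P.castGe (p.base.edgeOf_branchMap b').symm (p.hE (X.graph.edgeOf b') x)) * k⁻¹) * (gV p S y w)⁻¹ =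
    gV p S y w * k *
        (S.conjugator hab * P.brHom (p.base.branchMap b') (p.base.vertexMap w)
          (p.base.abuts_branchMap b' w h')
          (P.castGe (p.base.edgeOf_branchMap b').symm (gE p S z (X.graph.edgeOf b'))))⁻¹ *
      (S.conjugator hab * P.brHom (p.base.branchMap b') (p.base.vertexMap w)
          (p.base.abuts_branchMap b' w h')
          (P.castGe (p.base.edgeOf_branchMap b').symm
            (gE p S z (X.graph.edgeOf b') * p.hE (X.graph.edgeOf b') x * (gE p S z (X.graph.edgeOf b'))⁻¹)) *
        (S.conjugator hab)⁻¹) *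
      (gV p S y w * k *
        (S.conjugator hab * P.brHom (p.base.branchMap b') (p.base.vertexMap w)
          (p.base.abuts_branchMap b' w h')
          (P.castGe (p.base.edgeOf_branchMap b').symm (gE p S z (X.graph.edgeOf b'))))⁻¹)⁻¹
  rw [castGe_mul, castGe_mul, castGe_inv, map_mul, map_mul, map_inv]
  group

/-- **The morphism `X → 𝒢_S` of profinite presentations over the point lift, under the WEAK stabiliser condition**
(abc-iut-L3-t3's `pointHom` with (PS2) weakened to `⊆`). [cite: MochizukiSemiAnbd2006, Def 3.5(i) p.37] -/
def pointHomLE (hPA : PointAligned p S y z) : Hom X S.coveringGraph where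
  base := S.pointLift p.base y z hglue
  hV w := pointHVLE p S y z hS w
  hE e' := pointHELE p S y z hS e'
  comm b' w h' := pointHomLE_comm p S y z hglue hS hPA b' w h'

/-- The underlying morphism of semi-graphs is abc-iut-L3-t3's point lift. [cite: MochizukiSemiAnbd2006, Def 3.5(i) p.37] -/
@[simp] theorem pointHomLE_base (hPA : PointAligned p S y z) :
    (pointHomLE p S y z hglue hS hPA).base = S.pointLift p.base y z hglue := rfl

/-- **`X → 𝒢_S` lies over `p` on underlying semi-graphs.** [cite: MochizukiSemiAnbd2006, Def 3.5(i) p.37] -/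
theorem pointHomLE_base_comp (hPA : PointAligned p S y z) :
    (pointHomLE p S y z hglue hS hPA).base ≫ (show S.coveringGraph.graph ⟶ P.graph from S.coveringHom.base) = p.base :=
  S.pointLift_comp_base p.base y z hglue

/-- The vertex constituents of `X → 𝒢_S` ARE the conjugated homomorphisms `pointHVLE` (so, followed by the inclusion
`Stab ↪ Π_{P,p w}`, they are `p_w` conjugated by `g_w`: `pointHVLE_apply_coe` — the constituent triangles over `p` commute up
to an inner automorphism). [cite: MochizukiSemiAnbd2006, Def 3.5(i) p.37] -/
theorem pointHomLE_hV (hPA : PointAligned p S y z) (w : X.graph.Vertex) :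
    (pointHomLE p S y z hglue hS hPA).hV w = pointHVLE p S y z hS w := rfl

/-- The same for the edge constituents. [cite: MochizukiSemiAnbd2006, Def 3.5(i) p.37] -/
theorem pointHomLE_hE (hPA : PointAligned p S y z) (e' : X.graph.Edge) :
    (pointHomLE p S y z hglue hS hPA).hE e' = pointHELE p S y z hS e' := rfl

end CovObj

/-! ## §2. The fibre square: the second projection `𝒢'_{ψ^* S} → 𝒢_S` -/

namespace Hom

variable {H₁ K : ProfiniteSemiGraph.{u}} (ψ : Hom H₁ K) (θ : ψ.ConjugatorFamily) (S : CovObj K)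

/-- The TAUTOLOGICAL vertex points of the composite `𝒢'_{ψ^*S} → G′ → G`: at the vertex-orbit `(w, o)` of `𝒢'_{ψ^*S}` the
chosen base point `pt o ∈ (ψ^*S)_w = S_{ψ w}`. [cite: MochizukiSemiAnbd2006, Prop 3.6(iv) p.39] -/
def covPullbackPtV (ν : ((ψ.covPullbackWith θ).obj S).coveringSemiGraph.Vertex) :
    (S.SV ((((ψ.covPullbackWith θ).obj S).coveringHom.comp ψ).base.vertexMap ν)).obj.V :=
  Quot.out ν.2

/-- The TAUTOLOGICAL edge points: `pt ω ∈ (ψ^*S)_{e'} = S_{ψ e'}`. [cite: MochizukiSemiAnbd2006, Prop 3.6(iv) p.39] -/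
def covPullbackPtE (ε : ((ψ.covPullbackWith θ).obj S).coveringSemiGraph.Edge) :
    (S.SE ((((ψ.covPullbackWith θ).obj S).coveringHom.comp ψ).base.edgeMap ε)).obj.V :=
  Quot.out ε.2

/-- Transport bookkeeping: the `▸` of `covPullbackWith_glue_apply` is abc-iut-L3-t3's `castPtE` along the symmetric
equality. [cite: MochizukiSemiAnbd2006, Def 3.5(i) p.37] -/
theorem eqRec_eq_castPtE {e₁ e₂ : K.graph.Edge} (h : e₁ = e₂) (t : (S.SE e₂).obj.V) :
    (h ▸ t : (S.SE e₁).obj.V) = S.castPtE h.symm t := by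
  subst h; rfl

/-- **Gluing condition** for the tautological point system: along a branch-orbit `(b′, ω)` of `𝒢'_{ψ^*S}` abutting to
`(w, o)`, the gluing of `S` along `ψ b′` carries `pt ω` into the `Π_{G,ψ w}`-orbit of `pt o` — because the gluing of `ψ^*S`
along `b′` IS that gluing followed by `θ_{b′}`, and it carries `pt ω` into the (smaller) `Π_{G′,w}`-orbit `o`.
[cite: MochizukiSemiAnbd2006, Prop 3.6(iv) p.39] -/
theorem covPullback_glueCondition :
    S.GlueCondition (((ψ.covPullbackWith θ).obj S).coveringHom.comp ψ).base (ψ.covPullbackPtV θ S)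
      (ψ.covPullbackPtE θ S) := by
  refine ⟨fun β ν h => ?_⟩
  obtain ⟨b', ω⟩ := β
  obtain ⟨w, o⟩ := ν
  have hb : H₁.graph.abuts b' = some w := ((ψ.covPullbackWith θ).obj S).abuts_of_coveringAbuts h
  -- incidence in `𝒢'_{ψ^*S}`: some `c' ∈ Π_{G',w}` carries the glued point of `pt ω` (for `ψ^*S`) to `pt o`
  have hc := ((ψ.covPullbackWith θ).obj S).conjugator_spec h
  rw [covPullbackWith_glue_apply, S.eqRec_eq_castPtE (ψ.base.edgeOf_branchMap b')] at hc
  change (S.SV (ψ.base.vertexMap w)).obj.ρ (ψ.hV w (((ψ.covPullbackWith θ).obj S).conjugator h)) _ = _ at hc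
  rw [← ρ_mul_apply] at hc
  -- hence the glued point of `pt ω` for `S` lies in the `Π_{G,ψ w}`-orbit of `pt o`
  change BTemp.cl (S.SV (ψ.base.vertexMap w))
      ((S.glue (ψ.base.branchMap b') (ψ.base.vertexMap w) _).hom.hom.hom
        (S.castPtE _ (Quot.out ω))) = BTemp.cl (S.SV (ψ.base.vertexMap w)) (Quot.out o)
  rw [BTemp.cl_eq_cl_iff]
  exact ⟨_, hc⟩

/-- **Weak stabiliser condition** for the tautological point system: the constituent of the composite at `(w, o)` is `ψ_w`
restricted to `Stab_{Π_{G′,w}}(pt o)` (for the action THROUGH `ψ_w`), so it lands in `Stab_{Π_{G,ψ w}}(pt o)`.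
[cite: MochizukiSemiAnbd2006, Rem. 2.2.1 p.24] -/
theorem covPullback_stabLE :
    CovObj.StabLE (((ψ.covPullbackWith θ).obj S).coveringHom.comp ψ) S (ψ.covPullbackPtV θ S)
      (ψ.covPullbackPtE θ S) :=
  ⟨fun _ x => x.2, fun _ x => x.2⟩

/-- **(PS3) point alignment** for the tautological point system: along `(b′, ω) ↦ (w, o)` the aligned conjugator is
`k := ψ_w(c′) · θ_{b′}` (`c′` the incidence conjugator of `𝒢'_{ψ^*S}`, `θ_{b′}` the 2-cell of `ψ`): it conjugates
`(ψ b′)_* ∘ ψ_{e′}` into `ψ_w ∘ (c′ b′_* c′⁻¹)` and carries the glued point of `pt ω` to `pt o`.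
[cite: MochizukiSemiAnbd2006, Rmk 2.4.2 p.26] -/
theorem covPullback_pointAligned :
    CovObj.PointAligned (((ψ.covPullbackWith θ).obj S).coveringHom.comp ψ) S (ψ.covPullbackPtV θ S)
      (ψ.covPullbackPtE θ S) := by
  refine ⟨fun β ν h => ?_⟩
  obtain ⟨b', ω⟩ := β
  obtain ⟨w, o⟩ := ν
  have hb : H₁.graph.abuts b' = some w := ((ψ.covPullbackWith θ).obj S).abuts_of_coveringAbuts h
  have hc := ((ψ.covPullbackWith θ).obj S).conjugator_spec h
  rw [covPullbackWith_glue_apply, S.eqRec_eq_castPtE (ψ.base.edgeOf_branchMap b')] at hc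
  change (S.SV (ψ.base.vertexMap w)).obj.ρ (ψ.hV w (((ψ.covPullbackWith θ).obj S).conjugator h)) _ = _ at hc
  rw [← ρ_mul_apply] at hc
  refine ⟨ψ.hV w (((ψ.covPullbackWith θ).obj S).conjugator h) * θ.θ b' w hb, fun x => ?_, hc⟩
  -- the composite constituent on a stabiliser element `x` is `ψ_w (c′ · b′_*(x) · c′⁻¹)`; then the 2-cell of `ψ`
  show ψ.hV w (((ψ.covPullbackWith θ).obj S).conjugator h * H₁.brHom b' w hb (x : H₁.Ge (H₁.graph.edgeOf b')) *
        (((ψ.covPullbackWith θ).obj S).conjugator h)⁻¹) =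
    ψ.hV w (((ψ.covPullbackWith θ).obj S).conjugator h) * θ.θ b' w hb *
      K.brHom (ψ.base.branchMap b') (ψ.base.vertexMap w) (ψ.base.abuts_branchMap b' w hb)
        (K.castGe (ψ.base.edgeOf_branchMap b').symm (ψ.hE (H₁.graph.edgeOf b') (x : H₁.Ge (H₁.graph.edgeOf b')))) *
      (ψ.hV w (((ψ.covPullbackWith θ).obj S).conjugator h) * θ.θ b' w hb)⁻¹
  rw [map_mul, map_mul, map_inv, θ.spec_castGe b' w hb]
  simp only [mul_assoc, mul_inv_rev]

/-- **The second projection of the fibre square**: the morphism of profinite presentations `𝒢'_{ψ^*S} → 𝒢_S` — on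
underlying semi-graphs `(w, o) ↦ (ψ w, Π_{G,ψ w}·pt o)` (abc-iut-L3-t3's point lift), on constituents `ψ_w` restricted to
the stabilisers followed by the conjugation into the chosen base points.  Together with `(ψ^*S).coveringHom` (the first
projection, a covering) this is the square print forms when «pulling back the finite étale morphism … to `H₁`» (Prop. 4.6)
and «base-changing … by some finite étale morphism» (Prop. 4.4 (i)). [cite: MochizukiSemiAnbd2006, Prop 3.6(iv) p.39] -/
def covPullbackSnd : Hom ((ψ.covPullbackWith θ).obj S).coveringGraph S.coveringGraph :=
  CovObj.pointHomLE (((ψ.covPullbackWith θ).obj S).coveringHom.comp ψ) S (ψ.covPullbackPtV θ S)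
    (ψ.covPullbackPtE θ S) (ψ.covPullback_glueCondition θ S) (ψ.covPullback_stabLE θ S)
    (ψ.covPullback_pointAligned θ S)

/-- The second projection on vertices: `(w, o) ↦ (ψ w, [pt o])`. [cite: MochizukiSemiAnbd2006, Prop 3.6(iv) p.39] -/
@[simp] theorem covPullbackSnd_base_vertexMap (ν : ((ψ.covPullbackWith θ).obj S).coveringSemiGraph.Vertex) :
    (ψ.covPullbackSnd θ S).base.vertexMap ν =
      ⟨ψ.base.vertexMap ν.1, BTemp.cl (S.SV (ψ.base.vertexMap ν.1)) (Quot.out ν.2)⟩ := rfl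

/-- The second projection on edges: `(e′, ω) ↦ (ψ e′, [pt ω])`. [cite: MochizukiSemiAnbd2006, Prop 3.6(iv) p.39] -/
@[simp] theorem covPullbackSnd_base_edgeMap (ε : ((ψ.covPullbackWith θ).obj S).coveringSemiGraph.Edge) :
    (ψ.covPullbackSnd θ S).base.edgeMap ε =
      ⟨ψ.base.edgeMap ε.1, BTemp.cl (S.SE (ψ.base.edgeMap ε.1)) (Quot.out ε.2)⟩ := rfl

/-- **THE FIBRE SQUARE on underlying semi-graphs**: second projection then the covering `𝒢_S → G` equals the covering
`𝒢'_{ψ^*S} → G′` then `ψ`. [cite: MochizukiSemiAnbd2006, Prop 3.6(iv) p.39] -/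
theorem covPullbackSnd_base_comp :
    (ψ.covPullbackSnd θ S).base ≫ (show S.coveringGraph.graph ⟶ K.graph from S.coveringHom.base) =
      (show ((ψ.covPullbackWith θ).obj S).coveringGraph.graph ⟶ H₁.graph
          from ((ψ.covPullbackWith θ).obj S).coveringHom.base) ≫ ψ.base :=
  CovObj.pointHomLE_base_comp _ S _ _ _ _ _

/-- The vertex constituents of the second projection ARE `pointHVLE` for the tautological point system: `ψ_w` on the
stabiliser followed by conjugation by abc-iut-L3-t3's chosen `g_{(w,o)} ∈ Π_{G,ψ w}`. [cite: MochizukiSemiAnbd2006, Rmk 2.4.2 p.26] -/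
theorem covPullbackSnd_hV (ν : ((ψ.covPullbackWith θ).obj S).coveringSemiGraph.Vertex) :
    (ψ.covPullbackSnd θ S).hV ν =
      CovObj.pointHVLE (((ψ.covPullbackWith θ).obj S).coveringHom.comp ψ) S (ψ.covPullbackPtV θ S)
        (ψ.covPullbackPtE θ S) (ψ.covPullback_stabLE θ S) ν := rfl

/-- The edge constituents likewise. [cite: MochizukiSemiAnbd2006, Rmk 2.4.2 p.26] -/
theorem covPullbackSnd_hE (ε : ((ψ.covPullbackWith θ).obj S).coveringSemiGraph.Edge) :
    (ψ.covPullbackSnd θ S).hE ε =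
      CovObj.pointHELE (((ψ.covPullbackWith θ).obj S).coveringHom.comp ψ) S (ψ.covPullbackPtV θ S)
        (ψ.covPullbackPtE θ S) (ψ.covPullback_stabLE θ S) ε := rfl

/-- **The constituent squares commute up to conjugation** (vertices): in `Π_{G,ψ w}`, the second projection's value on
`x ∈ Π_{𝒢'_{ψ^*S},(w,o)} = Stab_{Π_{G′,w}}(pt o)` is `g · ψ_w(x) · g⁻¹`, `g = g_{(w,o)}` — i.e.
`(𝒢_S → G)_{ν′} ∘ snd_ν = Inn(g) ∘ ψ_w ∘ (𝒢'_{ψ^*S} → G′)_ν`, the shape of `ProfiniteSemiGraph.Hom.comm`.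
[cite: MochizukiSemiAnbd2006, Rmk 2.4.2 p.26] -/
theorem covPullbackSnd_hV_coe (ν : ((ψ.covPullbackWith θ).obj S).coveringSemiGraph.Vertex)
    (x : ((ψ.covPullbackWith θ).obj S).coveringGraph.Gv ν) :
    ((ψ.covPullbackSnd θ S).hV ν x).1 =
      CovObj.gV (((ψ.covPullbackWith θ).obj S).coveringHom.comp ψ) S (ψ.covPullbackPtV θ S) ν *
        (((ψ.covPullbackWith θ).obj S).coveringHom.comp ψ).hV ν x *
        (CovObj.gV (((ψ.covPullbackWith θ).obj S).coveringHom.comp ψ) S (ψ.covPullbackPtV θ S) ν)⁻¹ :=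
  rfl

/-- The same for the edge constituents. [cite: MochizukiSemiAnbd2006, Rmk 2.4.2 p.26] -/
theorem covPullbackSnd_hE_coe (ε : ((ψ.covPullbackWith θ).obj S).coveringSemiGraph.Edge)
    (x : ((ψ.covPullbackWith θ).obj S).coveringGraph.Ge ε) :
    ((ψ.covPullbackSnd θ S).hE ε x).1 =
      CovObj.gE (((ψ.covPullbackWith θ).obj S).coveringHom.comp ψ) S (ψ.covPullbackPtE θ S) ε *
        (((ψ.covPullbackWith θ).obj S).coveringHom.comp ψ).hE ε x *
        (CovObj.gE (((ψ.covPullbackWith θ).obj S).coveringHom.comp ψ) S (ψ.covPullbackPtE θ S) ε)⁻¹ :=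
  rfl

/-- The composite's vertex constituent is `ψ_w` on the underlying element (`rfl`-bookkeeping for the two lemmas above).
[cite: MochizukiSemiAnbd2006, Rmk 2.4.2 p.26] -/
theorem coveringHom_comp_hV_apply (ν : ((ψ.covPullbackWith θ).obj S).coveringSemiGraph.Vertex)
    (x : ((ψ.covPullbackWith θ).obj S).coveringGraph.Gv ν) :
    (((ψ.covPullbackWith θ).obj S).coveringHom.comp ψ).hV ν x = ψ.hV ν.1 x.1 := rfl

/-- … and its edge constituent is `ψ_{e′}` on the underlying element. [cite: MochizukiSemiAnbd2006, Rmk 2.4.2 p.26] -/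
theorem coveringHom_comp_hE_apply (ε : ((ψ.covPullbackWith θ).obj S).coveringSemiGraph.Edge)
    (x : ((ψ.covPullbackWith θ).obj S).coveringGraph.Ge ε) :
    (((ψ.covPullbackWith θ).obj S).coveringHom.comp ψ).hE ε x = ψ.hE ε.1 x.1 := rfl

/-- The second projection is injective on a vertex constituent where `ψ` is. [cite: MochizukiSemiAnbd2006, Rem. 2.2.1 p.24] -/
theorem covPullbackSnd_hV_injective (ν : ((ψ.covPullbackWith θ).obj S).coveringSemiGraph.Vertex)
    (hψ : Function.Injective (ψ.hV ν.1)) : Function.Injective ((ψ.covPullbackSnd θ S).hV ν) := by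
  rw [covPullbackSnd_hV]
  refine CovObj.pointHVLE_injective (((ψ.covPullbackWith θ).obj S).coveringHom.comp ψ) S (ψ.covPullbackPtV θ S)
    (ψ.covPullbackPtE θ S) (ψ.covPullback_stabLE θ S) ν ?_
  show Function.Injective fun a => ψ.hV ν.1 ((((ψ.covPullbackWith θ).obj S).coveringHom.hV ν) a)
  exact hψ.comp (((ψ.covPullbackWith θ).obj S).coveringHom_hV_injective ν)

/-- The second projection is injective on an edge constituent where `ψ` is. [cite: MochizukiSemiAnbd2006, Rem. 2.2.1 p.24] -/
theorem covPullbackSnd_hE_injective (ε : ((ψ.covPullbackWith θ).obj S).coveringSemiGraph.Edge)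
    (hψ : Function.Injective (ψ.hE ε.1)) : Function.Injective ((ψ.covPullbackSnd θ S).hE ε) := by
  rw [covPullbackSnd_hE]
  refine CovObj.pointHELE_injective (((ψ.covPullbackWith θ).obj S).coveringHom.comp ψ) S (ψ.covPullbackPtV θ S)
    (ψ.covPullbackPtE θ S) (ψ.covPullback_stabLE θ S) ε ?_
  show Function.Injective fun a => ψ.hE ε.1 ((((ψ.covPullbackWith θ).obj S).coveringHom.hE ε) a)
  exact hψ.comp (((ψ.covPullbackWith θ).obj S).coveringHom_hE_injective ε)

end Hom

end ProfiniteSemiGraph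

end Literature.AnabelianGeometry.SemiGraphs

end
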